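import Summits.ResolutionOfSingularities.ResolutionOfSingularities.Theorems.PurelyInseparableDim4ChartAtlasSNCFarChart
import Summits.ResolutionOfSingularities.ResolutionOfSingularities.Theorems.PurelyInseparableDim4ChartAtlasFarMemberDictionary
import Summits.ResolutionOfSingularities.ResolutionOfSingularities.Theorems.PurelyInseparableDim4ChartAtlasSNCRepairStep
import HarnessLib

/-!
# Purely inseparable four-folds `z^p + F(x₁, …, x₄)`: after the FAR-RESONANCE REPAIR blow-up of `Σ = V(y_0, y_T, y_j)` — readings on the
# `y_j`-chart: the escaping centre survives, every RESONANT member leaves it (S3-N2 repair, far class, step 2; typ-2 g6)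

[OURS · counted 0] (D-0157 DOOR 2; DR-157-C; desk WORD #115 (a)/(c), #131 (c)). Step 1 (p-`…SNCFarRepair`): in the translated frame of the
`x_j`-chart the repair centre `Σ = V(y_0, y_T, y_j)` is snc with the boundary. Step 2, for ANY blowing up `π' : W' → 𝔸⁵` along `𝓘_Σ`
(`= 𝓘Λ (insert 0 (insert j T)⁺)`), on the chart `y_j` — the ONLY chart meeting the strict transform of the escaping centre (p693365
`support_strictTransformIdeal_𝓘Λ_subset_opensRange`). PROVED here (no `sorry`, no new axiom):

* `comap_chartImm_strictTransform_escapingCentre_after_farRepair` — `St(V(y_0, y_T))` reads `𝓘Λ_T = V(y_0, y_T)` again (p693365);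
* `comap_chartImm_strictTransform_farHyperplane_after_farRepair` — the resonant far hyperplane `y_j·𝒪` DIES (`⊤`: `y_j` is the exceptional variable);
* `comap_chartImm_strictTransform_resonant_after_farRepair` — a RESONANT quadric `TQ_k = ((y_k + b_k)·y_j - c'·y_k)·𝒪` (`k ∈ T`, `b_k ≠ 0`)
  reads `(y_k·(y_j - c') + b_k)·𝒪`, and `disjoint_support_resonant_strictTransform_CΛ`: this MISSES `V(y_0, y_T)` (`≡ b_k` there);
* `comap_chartImm_strictTransform_nonresonant_after_farRepair` — a NON-resonant quadric (`e_k ≠ 0`) reads its total transform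
  `((y_j·y_k + b_k)·y_j - c'·y_j·y_k + e_k)·𝒪` for `k ∈ T` (a CUBIC, still meeting `V(y_0, y_T)` at the height `y_j = -e_k/b_k`) and itself for
  `k ∉ T` (p705352's dictionary);
* `comap_chartImm_exceptional_after_farRepair` — the new exceptional component reads `y_j·𝒪`, transversal to `V(y_0, y_T)`.

So ONE blow-up of `Σ` removes EVERY resonance at the height of the far hyperplane (all resonant quadrics at once, twin resonances among them
included); the remaining far members keep their pairwise distinct heights. Step 3 (the chart-level snc after the repair) and the W′-level statement are
the next files. Nothing here is a statement about resolution of singularities in dimension ≥ 4 / characteristic `p` (NOT proved anywhere in this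
programme). bears_on: LADDER-RESOLUTION:D157-DOOR2 (res-dim4-pi). Supports stmt-ResolutionOfSingularities-16155 (helper, S3-N2 far repair).
-/

-- every declaration of this summit lives under `Summit.ResolutionOfSingularities.ResolutionOfSingularities`
-- (summit = problem), which the duplicate-namespace linter flags; house convention (cf. the Target file).
set_option linter.dupNamespace false

noncomputable section

open MvPolynomial CategoryTheory AlgebraicGeometry Opposite TopologicalSpace
open AlgebraicGeometry.Scheme.IdealSheafData (ofIdealTop)

namespace Summit.ResolutionOfSingularities.ResolutionOfSingularities.Theorems.PIDim4

open Literature.AlgebraicGeometry.Resolution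
open Literature.AlgebraicGeometry.Resolution.AffinePointBlowup (P A γ coord Wtop ξ)
open Literature.AlgebraicGeometry.Hironaka2017.SpecOrders

namespace ChartDictionary

variable {K : Type} [Field K] {T : Finset (Fin 4)} {j : Fin 4} {b e : Fin 4 → K} {c' : K} {W' : Scheme.{0}} {π' : W' ⟶ P 4 K}

/-- The centre variables of `Σ`: `{0} ∪ T⁺ ⊆ {0} ∪ (insert j T)⁺`. -/
theorem centreVars_subset_centreVars_insert (T : Finset (Fin 4)) (j : Fin 4) :
    (insert 0 (Fin.succ '' (T : Set (Fin 4))) : Set (Fin (4 + 1))) ⊆ insert 0 (Fin.succ '' ((insert j T : Finset (Fin 4)) : Set (Fin 4))) :=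
  Set.insert_subset_insert (Set.image_mono (by rw [Finset.coe_insert]; exact Set.subset_insert _ _))

/-- **The escaping centre survives the repair**: on the `y_j`-chart of ANY blowing up of `𝔸⁵` along `Σ = V(y_0, y_T, y_j)` (`j ∉ T`) the strict
transform of `V(y_0, y_T)` reads `V(y_0, y_T)` (p693365). -/
theorem comap_chartImm_strictTransform_escapingCentre_after_farRepair (hjT : j ∉ T)
    (hπ' : IsBlowup π' (AffineCoordBlowup.𝓘Λ 4 K (insert 0 (Fin.succ '' ((insert j T : Finset (Fin 4)) : Set (Fin 4)))))) :
    (strictTransformIdeal π' (AffineCoordBlowup.𝓘Λ 4 K (insert 0 (Fin.succ '' ((insert j T : Finset (Fin 4)) : Set (Fin 4)))))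
        (AffineCoordBlowup.𝓘Λ 4 K (insert 0 (Fin.succ '' (T : Set (Fin 4)))))).comap
        (AffineCoordBlowup.chartImm hπ' (succ_mem_centreVars (Finset.mem_insert_self j T))) =
      AffineCoordBlowup.𝓘Λ 4 K (insert 0 (Fin.succ '' (T : Set (Fin 4)))) :=
  comap_chartImm_strictTransformIdeal_𝓘Λ_of_subset hπ' (centreVars_subset_centreVars_insert T j) _
    (fun h => hjT ((succ_mem_centreVars_iff T j).mp h))

/-- **… and lives on the `y_j`-chart only.** -/
theorem support_strictTransform_escapingCentre_after_farRepair_subset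
    (hπ' : IsBlowup π' (AffineCoordBlowup.𝓘Λ 4 K (insert 0 (Fin.succ '' ((insert j T : Finset (Fin 4)) : Set (Fin 4)))))) :
    ((strictTransformIdeal π' (AffineCoordBlowup.𝓘Λ 4 K (insert 0 (Fin.succ '' ((insert j T : Finset (Fin 4)) : Set (Fin 4)))))
        (AffineCoordBlowup.𝓘Λ 4 K (insert 0 (Fin.succ '' (T : Set (Fin 4)))))).support : Set W') ⊆
      (AffineCoordBlowup.chartImm hπ' (succ_mem_centreVars (Finset.mem_insert_self j T))).opensRange := by
  refine support_strictTransformIdeal_𝓘Λ_subset_opensRange hπ' (centreVars_subset_centreVars_insert T j) _ ?_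
  rintro m (rfl | ⟨t, ht, rfl⟩)
  · exact Set.mem_insert_of_mem _ (Set.mem_insert _ _)
  · rcases Finset.mem_insert.mp (Finset.mem_coe.mp ht) with rfl | ht
    · exact Set.mem_insert _ _
    · exact Set.mem_insert_of_mem _ (Set.mem_insert_of_mem _ ⟨t, Finset.mem_coe.mpr ht, rfl⟩)

/-- **The resonant far hyperplane `y_j·𝒪` dies** on the `y_j`-chart of the repair (it contains `Σ`; `y_j` is the exceptional variable there). -/
theorem comap_chartImm_strictTransform_farHyperplane_after_farRepair
    (hπ' : IsBlowup π' (AffineCoordBlowup.𝓘Λ 4 K (insert 0 (Fin.succ '' ((insert j T : Finset (Fin 4)) : Set (Fin 4)))))) :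
    (strictTransformIdeal π' (AffineCoordBlowup.𝓘Λ 4 K (insert 0 (Fin.succ '' ((insert j T : Finset (Fin 4)) : Set (Fin 4)))))
        (ofIdealTop (Ideal.span {(γ 4 K).symm (X j.succ + C 0)}))).comap
        (AffineCoordBlowup.chartImm hπ' (succ_mem_centreVars (Finset.mem_insert_self j T))) = ⊤ := by
  rw [C_0, add_zero]
  exact strictTransformIdeal_hyperplane_self_comap_chartImm (Finset.mem_insert_self j T) hπ'

/-- **A RESONANT quadric leaves the escaping centre**: `TQ_k = (y_k + b_k)·y_j - c'·y_k` (`k ∈ T`, `b_k ≠ 0`) reads `(y_k·(y_j - c') + b_k)·𝒪` on the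
`y_j`-chart of the repair (`ψ_j TQ_k = y_j · (y_k (y_j - c') + b_k)`, one exceptional factor divided out — p696894's engine with `k = 1`). -/
theorem comap_chartImm_strictTransform_resonant_after_farRepair (hjT : j ∉ T) {k : Fin 4} (hkT : k ∈ T) (hbk : b k ≠ 0)
    (hπ' : IsBlowup π' (AffineCoordBlowup.𝓘Λ 4 K (insert 0 (Fin.succ '' ((insert j T : Finset (Fin 4)) : Set (Fin 4)))))) :
    (strictTransformIdeal π' (AffineCoordBlowup.𝓘Λ 4 K (insert 0 (Fin.succ '' ((insert j T : Finset (Fin 4)) : Set (Fin 4)))))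
        (ofIdealTop (Ideal.span {(γ 4 K).symm ((X k.succ + C (b k)) * X j.succ - C c' * X k.succ + C 0)}))).comap
        (AffineCoordBlowup.chartImm hπ' (succ_mem_centreVars (Finset.mem_insert_self j T))) =
      ofIdealTop (Ideal.span {(γ 4 K).symm (X k.succ * (X j.succ - C c') + C (b k))}) := by
  classical
  have hkj : k ≠ j := fun h => hjT (h ▸ hkT)
  refine strictTransformIdeal_principal_comap_chartImm (Finset.mem_insert_self j T) 1 ?_ ?_ hπ'
  · rw [C_0, add_zero, map_sub, map_mul, map_add, map_mul, coordBlowupSubst_C, coordBlowupSubst_C, coordBlowupSubst_X_self,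
      coordBlowupSubst_X_of_mem_of_ne K _ j.succ (succ_mem_centreVars (Finset.mem_insert_of_mem hkT))
        (fun h => hkj (Fin.succ_injective _ h))]
    ring
  · refine not_coord_dvd_γ_symm_of_constantCoeff_ne_zero _ ?_
    simp only [map_add, map_mul, map_sub, constantCoeff_X, constantCoeff_C, zero_add, zero_mul]
    exact hbk

/-- **… and the reading MISSES `V(y_0, y_T)`** (`k ∈ T`: on `V(y_T)` the polynomial `y_k (y_j - c') + b_k` is the unit `b_k`). -/
theorem disjoint_support_resonant_strictTransform_CΛ {k : Fin 4} (hkT : k ∈ T) (hbk : b k ≠ 0) :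
    Disjoint ((ofIdealTop (Ideal.span {(γ 4 K).symm (X k.succ * (X j.succ - C c') + C (b k))})).support : Set (P 4 K))
      (AffineCoordBlowup.CΛ 4 K (insert 0 (Fin.succ '' (T : Set (Fin 4)))) : Set (P 4 K)) := by
  rw [Set.disjoint_left]
  intro y hy hyC
  rw [SetLike.mem_coe, ofIdealTop_span_γ_symm_eq_shf, mem_support_shf_iff, Ideal.span_singleton_le_iff_mem] at hy
  have hXk : (X k.succ : A 4 K) ∈ y.asIdeal := (AffineCoordBlowup.mem_CΛ_iff' 4 K _ y).mp hyC _ (succ_mem_centreVars hkT)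
  have hb' : (C (b k) : A 4 K) ∈ y.asIdeal := by
    have h := y.asIdeal.sub_mem hy (y.asIdeal.mul_mem_right (X j.succ - C c') hXk)
    rwa [add_sub_cancel_left] at h
  exact hbk ((C_mem_asIdeal_iff y _).mp hb')

/-- **A NON-resonant far quadric with `k ∈ T` becomes a CUBIC** on the `y_j`-chart of the repair: `TQ_k = (y_k + b_k)·y_j - c'·y_k + e_k`, `e_k ≠ 0`,
reads its total transform `((y_j·y_k + b_k)·y_j - c'·y_j·y_k + e_k)·𝒪` (p705352: it misses the origin). -/
theorem comap_chartImm_strictTransform_nonresonant_after_farRepair (hjT : j ∉ T) {k : Fin 4} (hkT : k ∈ T) (hek : e k ≠ 0)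
    (hπ' : IsBlowup π' (AffineCoordBlowup.𝓘Λ 4 K (insert 0 (Fin.succ '' ((insert j T : Finset (Fin 4)) : Set (Fin 4)))))) :
    (strictTransformIdeal π' (AffineCoordBlowup.𝓘Λ 4 K (insert 0 (Fin.succ '' ((insert j T : Finset (Fin 4)) : Set (Fin 4)))))
        (ofIdealTop (Ideal.span {(γ 4 K).symm ((X k.succ + C (b k)) * X j.succ - C c' * X k.succ + C (e k))}))).comap
        (AffineCoordBlowup.chartImm hπ' (succ_mem_centreVars (Finset.mem_insert_self j T))) =
      ofIdealTop (Ideal.span {(γ 4 K).symm ((X j.succ * X k.succ + C (b k)) * X j.succ - C c' * (X j.succ * X k.succ) + C (e k))}) := by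
  classical
  have hkj : k ≠ j := fun h => hjT (h ▸ hkT)
  have hψ : coordBlowupSubst K (insert 0 (Fin.succ '' ((insert j T : Finset (Fin 4)) : Set (Fin 4)))) j.succ
      ((X k.succ + C (b k)) * X j.succ - C c' * X k.succ + C (e k) : A 4 K) =
      (X j.succ * X k.succ + C (b k)) * X j.succ - C c' * (X j.succ * X k.succ) + C (e k) := by
    simp only [map_add, map_sub, map_mul, coordBlowupSubst_C, coordBlowupSubst_X_self,
      coordBlowupSubst_X_of_mem_of_ne K _ j.succ (succ_mem_centreVars (Finset.mem_insert_of_mem hkT)) (fun h => hkj (Fin.succ_injective _ h))]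
  rw [strictTransformIdeal_comap_chartImm_of_constantCoeff_ne_zero (Finset.mem_insert_self j T) ?_ hπ', hψ]
  simp only [map_add, map_mul, map_sub, constantCoeff_X, constantCoeff_C, zero_add, mul_zero, sub_zero]
  exact hek

/-- **A far quadric with `k ∉ T` (hence `k⁺ ∉ Σ`'s variables, `k ≠ j`) keeps its shape** on the `y_j`-chart of the repair (`e_k ≠ 0`). -/
theorem comap_chartImm_strictTransform_tquadric_of_not_mem_after_farRepair {k : Fin 4} (hkT : k ∉ T) (hkj : k ≠ j) (hek : e k ≠ 0)
    (hπ' : IsBlowup π' (AffineCoordBlowup.𝓘Λ 4 K (insert 0 (Fin.succ '' ((insert j T : Finset (Fin 4)) : Set (Fin 4)))))) :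
    (strictTransformIdeal π' (AffineCoordBlowup.𝓘Λ 4 K (insert 0 (Fin.succ '' ((insert j T : Finset (Fin 4)) : Set (Fin 4)))))
        (ofIdealTop (Ideal.span {(γ 4 K).symm ((X k.succ + C (b k)) * X j.succ - C c' * X k.succ + C (e k))}))).comap
        (AffineCoordBlowup.chartImm hπ' (succ_mem_centreVars (Finset.mem_insert_self j T))) =
      ofIdealTop (Ideal.span {(γ 4 K).symm ((X k.succ + C (b k)) * X j.succ - C c' * X k.succ + C (e k))}) := by
  classical
  have hk : k ∉ insert j T := fun h => by
    rcases Finset.mem_insert.mp h with h | h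
    · exact hkj h
    · exact hkT h
  have hψ : coordBlowupSubst K (insert 0 (Fin.succ '' ((insert j T : Finset (Fin 4)) : Set (Fin 4)))) j.succ
      ((X k.succ + C (b k)) * X j.succ - C c' * X k.succ + C (e k) : A 4 K) = (X k.succ + C (b k)) * X j.succ - C c' * X k.succ + C (e k) := by
    simp only [map_add, map_sub, map_mul, coordBlowupSubst_C, coordBlowupSubst_X_self,
      coordBlowupSubst_X_of_not_mem K _ j.succ (fun h => hk ((succ_mem_centreVars_iff _ k).mp h))]
  rw [strictTransformIdeal_comap_chartImm_of_constantCoeff_ne_zero (Finset.mem_insert_self j T) ?_ hπ', hψ]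
  simp only [map_add, map_mul, map_sub, constantCoeff_X, constantCoeff_C, zero_add, mul_zero, sub_zero]
  exact hek

/-- **The exceptional component of the repair reads `y_j·𝒪`** on the `y_j`-chart — a coordinate hyperplane transversal to `V(y_0, y_T)`. -/
theorem comap_chartImm_exceptional_after_farRepair
    (hπ' : IsBlowup π' (AffineCoordBlowup.𝓘Λ 4 K (insert 0 (Fin.succ '' ((insert j T : Finset (Fin 4)) : Set (Fin 4)))))) :
    ((AffineCoordBlowup.𝓘Λ 4 K (insert 0 (Fin.succ '' ((insert j T : Finset (Fin 4)) : Set (Fin 4))))).comap π').comap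
        (AffineCoordBlowup.chartImm hπ' (succ_mem_centreVars (Finset.mem_insert_self j T))) =
      ofIdealTop (Ideal.span {(γ 4 K).symm (X j.succ + C 0)}) := by
  rw [C_0, add_zero]
  exact comap_𝓘Λ_chartImm (Finset.mem_insert_self j T) hπ'

end ChartDictionary

end Summit.ResolutionOfSingularities.ResolutionOfSingularities.Theorems.PIDim4

end
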